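import Summits.BirchSwinnertonDyer.BirchSwinnertonDyer.Theorems.ErratumRoadFiveIMCDivGeneratorRoadTwoCopies
import HarnessLib

/-!
# Route `ErratumRoadFive`, crux `IMCDivAtErratumDataAll` (item stmt-BirchSwinnertonDyer-19270, H3♭),
# stubs S2 ∕ S1: the ONE-SIDED HEEGNER ⟶ BDP TRANSFER as module theory — erratum (2.4)
# `Ch_Λ(X_ac^∅)·𝓞_{ℂ_p}⟦T⟧ ⊆ (Q)` FROM the `Λ`-adic Kolyvagin-structure lower bound
# `Ch_Λ(X_tors) ⊆ Ch_Λ(𝔖∕Λκ_∞^*)²` (the half of Perrin-Riou's Heegner point main conjecture that is NOT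
# Howard's), via Castella JLMS17 App. A ∕ BCK21 Thm. 4.1 bookkeeping; PROOF-BDP §5.3's «Kolyvagin bridge» B4 in the kernel
# (cell `bsd-stepL`, PART 1b ACCEL seat `bsd-stepL-imc24b` g2; `--supports stmt-BirchSwinnertonDyer-19270`, helper; Theses-free)

THEOREMS ONLY (no definition, no named fact, no `sorry`); module theory with every cohomological input a
HYPOTHESIS on abstract `Λ`-modules (the tree has no `𝔖_p`, no `κ_∞`, no Coleman map); nothing asserted
about the objects; the style of `Literature.…Kato2004.MainConjectureSkeletonProofs`.

## The printed statement whose module theory this is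

F. Castella, *`p`-adic heights of Heegner points and Beilinson–Flach classes*, J. Lond. Math. Soc. 96
(2017), App. A (arXiv:1509.02761 pp. 18–20): Lemma A.3 «`ord_P(L_𝔭^{BDP}(f/K)) = length_P(coker(loc_𝔭)
R₀) + length_P(Sel(K,𝐓^{ac})R₀ ∕ Λ^{ac}_{R₀}·𝐳_f)`», Lemma A.4 «`length_P(X_{∅,0}) = length_P(X_tors) +
2·length_P(coker(loc_𝔭))`» from (A.5) `0 → coker(loc_𝔭) → X_{∅,Gr} → X → 0`, (A.6), (A.7)
`0 → coker(loc^∅_𝔭) → X_{∅,0} → X_{Gr,0} → 0` and Lemma 2.3(3) `Ch(X_{Gr,∅,tors}) = Ch(X_{Gr,0,tors})`;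
and Burungale–Castella–Kim, ANT 15 (2021) proof of Thm. 4.1 (arXiv:1908.09512 p. 9): «for any height
one prime 𝔓 … `length_𝔓(X_tors) ≤ 2·length_𝔓(Sel_Gr(K,𝐓)∕Λκ₁^∞) ⟺ length_𝔓(X_{∅,0}) ≤ 2·ord_{𝔓'}(𝓛_𝔭^{BDP})`,
and similarly for the opposite inequalities». At `p ∥ N` the explicit reciprocity law is Castella
arXiv:2409.01360 Thm. 2.2 ∕ Cor. 2.3 (PREPRINT) and the equivalence is its Prop. 3.2 («readily extracted
from [cas-BF] as in [BCK]», derived class `κ'_∞` at split `p`). Read at the tree's `Sel_𝔭` (strict at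
`𝔭`, relaxed at `𝔭̄`: Cas18 Def. 2.2) the two Coleman cokernels are at `𝔭̄` (into `X_{0,∅}`, (A.7)′) and
at `𝔭` (into `(X_{∅,Gr})_tors`, (A.5)), exactly as in `ErratumRoadFiveIMCDivGeneratorRoadTwoCopies`
(p473944), whose module docstring has the full bookkeeping and the square `Q = 𝓛²` (Cas18 Thm. 3.1 ∕
cas-split Thm. 2.10).

## What is proved (§1 generic over a Noetherian factorial domain; §2 over `Λ = ℤ_p⟦T⟧`; §3 at the tree's `X_ac^∅`)

* §1 `GeneratorRoad.charIdeal_quotient_span_eq_mul_of_injective` — for `loc : S ↪ P` injective and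
  `z ∈ S`: `char(P ∕ Λ·loc z) = char(S ∕ Λz) · char(P ∕ loc S)` (the exact sequence
  `0 → loc(S)∕Λ·loc z → P∕Λ·loc z → P∕loc(S) → 0` with `loc(S)∕Λ·loc z ≅ S∕Λz`; JLMS17 proof of Lemma A.3).
* §2 `GeneratorRoad.charIdeal_map_le_span_of_heegnerLowerBound` — **THE TRANSFER**: data `X` (`X_{0,∅}`,
  f.g. torsion), `T` (`(X_{∅,Gr})_tors`), `Xt` (`X_tors`), `S ∋ z ≠ 0` (`𝔖`, `κ_∞^*`; Cornut–Vatsal),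
  `loc_v : S ↪ P_v ≃ Λ` injective (`v = 𝔭̄, 𝔭`; `Sel_{0,Gr} = 0`, JLMS17 Lemma A.3; freeness from Cas24
  Thm. 2.2 ∕ Cor. 2.3); (A.7)′ `ι₁ : P₁∕loc₁ S ↪ X`; (2.3(3))′ `char(X ∕ ι₁) = char(T)`; (A.5)
  `0 → P₂∕loc₂ S → T → Xt → 0`; **(KS)** `char(Xt) ⊆ char(S∕Λz)²` — the Kolyvagin-structure lower bound;
  (ERL²) `φ(e₁(loc₁ z)·e₂(loc₂ z))·w = u·Q`. THEN `char(X)·Λ' ⊆ (Q)`. Proof: `char(S∕Λz)²·char(X) =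
  (a₁)(a₂)·char(Xt) ⊆ (a₁ a₂)·char(S∕Λz)²` and cancellation of the principal non-zero ideal `char(S∕Λz)²`
  (`charIdeal_isPrincipal_holds`; `Λ` a domain). ROAD G (p471922 ∕ p473944) is the case `S = Λz`.
* §3 `P2.imcDivIntCoreFrameAtDatum_of_heegnerLowerBound` — at the tree's `X_ac^∅(E_K[p^∞])`: the `∃`-body
  of `P2.IMCDivIntCoreFrameAtErratumData W p` at a datum from a printed frame + the transfer's hypotheses
  for its `Q`.

HONESTY: (KS) at `p ∥ N` erratum data is NOT in print (it is the `⊆` of Cas24 Thm. 1.3 that Cas24 itself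
deduces FROM the erratum IMC; independently it would follow from `Λ`-primitivity of the Heegner
Kolyvagin system + Howard ∕ Mazur–Rubin rigidity, i.e. SZ14-type input — PRE at `p ∥ N`); this file only
makes the bridge «(KS) ⟹ H3♭» kernel-checked modulo the Poitou–Tate ∕ Coleman inputs, so that a
Kolyvagin-side input, if it ever lands, is convertible into the crux's currency by name.

References (locators only): [cite: Castella2018Erratum, (2.4) (p. 4)]; [cite: Castella2018, Def. 2.2,
Thms. 3.1–3.2 (arXiv:1704.06608 pp. 5, 9)]; Castella JLMS 96 (2017) App. A Lemmas A.2–A.4, (A.5)–(A.7),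
Lemma 2.3 (arXiv:1509.02761 pp. 9–10, 18–20); Burungale–Castella–Kim ANT 15 (2021) Thm. 4.1
(arXiv:1908.09512 p. 9); Castella arXiv:2409.01360 Thms. 2.1–2.2, Cor. 2.3, Prop. 3.2, Thm. 1.3
(PREPRINT); Washington GTM 83 §13.2; Bourbaki AC VII §4.5 Prop. 10.
-/

noncomputable section

open scoped Classical

open WeierstrassCurve NumberField IsDedekindDomain Field PowerSeries
open Literature.NumberTheory.EllipticCurves Literature.NumberTheory.EllipticCurves.GreenbergSelmer
open Literature.NumberTheory.EllipticCurves.ModularForms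
open Literature.NumberTheory.EllipticCurves.Rank1Residual
open Literature.NumberTheory.EllipticCurves.Rank1Residual.Typed
open Literature.NumberTheory.EllipticCurves.Castella2018
open Literature.NumberTheory.GaloisRepresentations
open Literature.NumberTheory.GaloisCohomology
open Summit.BirchSwinnertonDyer.Rank1Residual.X11b.AcSelmer
open Summit.BirchSwinnertonDyer.Rank1Residual.X11b.Halves

namespace Summit.BirchSwinnertonDyer.Rank1Residual.X11b

namespace GeneratorRoad

open Literature.NumberTheory.EllipticCurves.Module

/-! ### §1 `char(P ∕ R·loc z) = char(S ∕ R·z) · char(P ∕ loc S)` for an injective `loc` -/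

section Quotients

variable {R : Type*} [CommRing R] {S P M : Type*} [AddCommGroup S] [Module R S] [AddCommGroup P]
  [Module R P] [AddCommGroup M] [Module R M]

/-- `R·loc z ≤ loc(S)` (as the hypothesis of `Submodule.mapQ` along the identity). [folklore] -/
theorem span_singleton_le_comap_id_range (loc : S →ₗ[R] P) (z : S) :
    Submodule.span R {loc z} ≤ (LinearMap.range loc).comap (LinearMap.id : P →ₗ[R] P) := by
  rw [Submodule.comap_id]
  exact Submodule.span_le.mpr (Set.singleton_subset_iff.mpr (LinearMap.mem_range_self loc z))

/-- For an injective `loc : S → P` and `z ∈ S`, the kernel of `P∕R·loc z ↠ P∕loc(S)` (the submodule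
`loc(S)∕R·loc z`) is `≃ S∕R·z`: it is the range of `S → P∕R·loc z`, whose kernel is
`loc⁻¹(R·loc z) = R·z` by injectivity. [folklore] -/
theorem nonempty_linearEquiv_ker_mapQ_of_injective (loc : S →ₗ[R] P) (hloc : Function.Injective loc)
    (z : S) (h : Submodule.span R {loc z} ≤ (LinearMap.range loc).comap (LinearMap.id : P →ₗ[R] P)) :
    Nonempty ((S ⧸ Submodule.span R {z}) ≃ₗ[R]
      LinearMap.ker (Submodule.mapQ (Submodule.span R {loc z}) (LinearMap.range loc) LinearMap.id h)) := by
  set ψ : S →ₗ[R] P ⧸ Submodule.span R {loc z} := (Submodule.span R {loc z}).mkQ ∘ₗ loc with hψ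
  have hker : LinearMap.ker ψ = Submodule.span R {z} := by
    rw [hψ, LinearMap.ker_comp, Submodule.ker_mkQ, ← Set.image_singleton, ← Submodule.map_span,
      Submodule.comap_map_eq_of_injective hloc]
  have hrange : LinearMap.range ψ =
      LinearMap.ker (Submodule.mapQ (Submodule.span R {loc z}) (LinearMap.range loc) LinearMap.id h) := by
    rw [Submodule.ker_mapQ, Submodule.comap_id, hψ, LinearMap.range_comp]
  exact ⟨(Submodule.quotEquivOfEq _ _ hker.symm).trans
    ((LinearMap.quotKerEquivRange ψ).trans (LinearEquiv.ofEq _ _ hrange))⟩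

/-- A module isomorphic to `R ⧸ (a)` with `a ≠ 0` (`R` a domain) is torsion. [folklore] -/
theorem isTorsion_of_linearEquiv_quotient_span_singleton [IsDomain R] {a : R} (ha : a ≠ 0)
    (ε : M ≃ₗ[R] R ⧸ Ideal.span {a}) : Module.IsTorsion R M := by
  intro x
  refine ⟨⟨a, mem_nonZeroDivisors_of_ne_zero ha⟩, ε.injective ?_⟩
  rw [Submonoid.mk_smul, map_smul, map_zero]
  obtain ⟨r, hr⟩ := Ideal.Quotient.mk_surjective (ε x)
  rw [← hr, Algebra.smul_def, Ideal.Quotient.algebraMap_eq, ← map_mul, Ideal.Quotient.eq_zero_iff_mem]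
  exact Ideal.mul_mem_right _ _ (Ideal.mem_span_singleton_self a)

variable [IsDomain R] [IsNoetherianRing R]

/-- **JLMS17, proof of Lemma A.3, as module theory**: for an injective `loc : S → P`
(`𝔖 ↪ H¹_Gr(K_v,𝐓)`: `Sel_{0,Gr} = 0`) and `z ∈ S` with `P ∕ R·loc z` finitely generated torsion,
`char(P ∕ R·loc z) = char(S ∕ R·z) · char(P ∕ loc S)` — multiplicativity of `char` in
`0 → loc(S)∕R·loc z → P∕R·loc z → P∕loc(S) → 0` («`ord_P(𝓛) = length_P(coker loc) + length_P(𝔖∕Λz)`»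
once `P ≅ Λ` and `char(P∕Λ·loc z) = (𝓛)`). [cite: Washington1997, §13.2]
[cite: BourbakiAC5to7, Ch. VII §4 no. 5, Prop. 10] -/
theorem charIdeal_quotient_span_eq_mul_of_injective (loc : S →ₗ[R] P) (hloc : Function.Injective loc)
    (z : S) [Module.Finite R (P ⧸ Submodule.span R {loc z})]
    (htor : Module.IsTorsion R (P ⧸ Submodule.span R {loc z})) :
    charIdeal R (P ⧸ Submodule.span R {loc z}) =
      charIdeal R (S ⧸ Submodule.span R {z}) * charIdeal R (P ⧸ LinearMap.range loc) := by
  have h := span_singleton_le_comap_id_range loc z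
  set g := Submodule.mapQ (Submodule.span R {loc z}) (LinearMap.range loc) LinearMap.id h with hg
  have hsurj : Function.Surjective g := fun y ↦ by
    obtain ⟨x, rfl⟩ := Submodule.mkQ_surjective _ y
    exact ⟨Submodule.Quotient.mk x, rfl⟩
  obtain ⟨ε⟩ := nonempty_linearEquiv_ker_mapQ_of_injective loc hloc z h
  rw [charIdeal_eq_mul_of_exact htor (LinearMap.ker g).subtype g (Submodule.injective_subtype _) hsurj
    (LinearMap.exact_subtype_ker_map g), ← charIdeal_eq_of_linearEquiv' ε]

end Quotients

/-! ### §2 THE TRANSFER: (KS) `char(X_tors) ⊆ char(𝔖∕Λκ*)²` ⟹ (2.4), over `Λ = ℤ_p⟦T⟧` -/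

section Transfer

variable {p : ℕ} [Fact p.Prime] {Λ' : Type*} [CommRing Λ'] (φ : IwasawaAlgebra p →+* Λ')
  {X T Xt S P₁ P₂ : Type*} [AddCommGroup X] [Module (IwasawaAlgebra p) X]
  [AddCommGroup T] [Module (IwasawaAlgebra p) T] [AddCommGroup Xt] [Module (IwasawaAlgebra p) Xt]
  [AddCommGroup S] [Module (IwasawaAlgebra p) S] [AddCommGroup P₁] [Module (IwasawaAlgebra p) P₁]
  [AddCommGroup P₂] [Module (IwasawaAlgebra p) P₂]

/-- The trivialised Coleman cokernel bookkeeping: for `loc : S ↪ P`, `e : P ≃ Λ`, `z ≠ 0`, put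
`a = e(loc z)`; then `a ≠ 0`, and `(a) = char(S∕Λz) · char(P∕loc S)`. [cite: Washington1997, §13.2] -/
theorem span_singleton_eq_charIdeal_mul_of_injective (loc : S →ₗ[IwasawaAlgebra p] P₁)
    (hloc : Function.Injective loc) (e : P₁ ≃ₗ[IwasawaAlgebra p] IwasawaAlgebra p) {z : S}
    (hz : z ≠ 0) :
    e (loc z) ≠ 0 ∧ Ideal.span {e (loc z)} =
      Literature.NumberTheory.EllipticCurves.Module.charIdeal (IwasawaAlgebra p)
          (S ⧸ Submodule.span (IwasawaAlgebra p) {z}) *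
        Literature.NumberTheory.EllipticCurves.Module.charIdeal (IwasawaAlgebra p)
          (P₁ ⧸ LinearMap.range loc) := by
  have ha : e (loc z) ≠ 0 := fun h ↦ by
    have h1 : loc z = 0 := e.injective (by rw [h, map_zero])
    exact hz (hloc (by rw [h1, map_zero]))
  -- `P ∕ Λ·loc z ≃ Λ ∕ (a)`
  have ε : (P₁ ⧸ Submodule.span (IwasawaAlgebra p) {loc z}) ≃ₗ[IwasawaAlgebra p]
      (IwasawaAlgebra p ⧸ Ideal.span {e (loc z)}) :=
    Submodule.Quotient.equiv _ _ e (by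
      rw [Submodule.map_span, Set.image_singleton]; rfl)
  haveI : Module.Finite (IwasawaAlgebra p) (P₁ ⧸ Submodule.span (IwasawaAlgebra p) {loc z}) :=
    Module.Finite.equiv ε.symm
  have htor := isTorsion_of_linearEquiv_quotient_span_singleton ha ε
  refine ⟨ha, ?_⟩
  rw [← charIdeal_quotient_span_singleton ha, ← charIdeal_eq_of_linearEquiv' ε]
  exact charIdeal_quotient_span_eq_mul_of_injective loc hloc z htor

/-- **THE ONE-SIDED HEEGNER ⟶ BDP TRANSFER (module theory).** Over `Λ = ℤ_p⟦T⟧` let `X` (`X_{0,∅} =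
X_ac^∅`), `T` (`(X_{∅,Gr})_tors`), `Xt` (`X_tors`) be finitely generated torsion modules, `S ∋ z ≠ 0`
(`𝔖 ∋ κ_∞^*`, non-torsion by Cornut–Vatsal), and for `v = 𝔭̄, 𝔭` injective `loc_v : S → P_v` with
`e_v : P_v ≃ Λ` (`Sel_{0,Gr} = 0`; `H¹_Gr(K_v,𝐓)` free of rank one). Assume **(A.7)′**
`ι₁ : P₁∕loc₁(S) ↪ X`; **(2.3(3))′** `char(X ∕ ι₁) = char(T)`; **(A.5)** `0 → P₂∕loc₂(S) → T → Xt → 0`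
exact; **(KS)** `char(Xt) ⊆ char(S∕Λz)²` — the `Λ`-adic Kolyvagin-structure lower bound
`Ch(X_tors) ⊆ Ch(𝔖∕Λκ_∞^*)²` (the half of the Heegner point main conjecture that is NOT Howard's;
Cas24 Prop. 3.2 (ii) `⊆`); **(ERL²)** `φ(e₁(loc₁ z)·e₂(loc₂ z))·w = u·Q` with units `w, u` (Cas24 Thm.
2.2 ∕ Cor. 2.3 at both primes above `p`, and `Q = 𝓛_𝔭̄·𝓛_𝔭·unit`). THEN `char_Λ(X)·Λ' ⊆ (Q)` — erratum
(2.4) for this `Q`. Proof: `char(S∕Λz)²·char(X) = (a₁)(a₂)·char(Xt) ⊆ (a₁a₂)·char(S∕Λz)²`, cancel the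
principal non-zero ideal `char(S∕Λz)²`. Module theory only; nothing asserted about the objects.
[cite: Castella2018Erratum, (2.4) (p. 4)] [cite: Washington1997, §13.2] -/
theorem charIdeal_map_le_span_of_heegnerLowerBound [Module.Finite (IwasawaAlgebra p) X]
    [Module.Finite (IwasawaAlgebra p) T] [Module.Finite (IwasawaAlgebra p) Xt]
    (hX : Module.IsTorsion (IwasawaAlgebra p) X) (hT : Module.IsTorsion (IwasawaAlgebra p) T)
    {z : S} (hz : z ≠ 0)
    (loc₁ : S →ₗ[IwasawaAlgebra p] P₁) (hloc₁ : Function.Injective loc₁)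
    (e₁ : P₁ ≃ₗ[IwasawaAlgebra p] IwasawaAlgebra p)
    (ι₁ : (P₁ ⧸ LinearMap.range loc₁) →ₗ[IwasawaAlgebra p] X) (hι₁ : Function.Injective ι₁)
    (h233 : Literature.NumberTheory.EllipticCurves.Module.charIdeal (IwasawaAlgebra p)
        (X ⧸ LinearMap.range ι₁) =
      Literature.NumberTheory.EllipticCurves.Module.charIdeal (IwasawaAlgebra p) T)
    (loc₂ : S →ₗ[IwasawaAlgebra p] P₂) (hloc₂ : Function.Injective loc₂)
    (e₂ : P₂ ≃ₗ[IwasawaAlgebra p] IwasawaAlgebra p)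
    (ι₂ : (P₂ ⧸ LinearMap.range loc₂) →ₗ[IwasawaAlgebra p] T) (π : T →ₗ[IwasawaAlgebra p] Xt)
    (hι₂ : Function.Injective ι₂) (hπ : Function.Surjective π) (hexact : Function.Exact ι₂ π)
    (hKS : Literature.NumberTheory.EllipticCurves.Module.charIdeal (IwasawaAlgebra p) Xt ≤
      Literature.NumberTheory.EllipticCurves.Module.charIdeal (IwasawaAlgebra p)
        (S ⧸ Submodule.span (IwasawaAlgebra p) {z}) ^ 2)
    {w u Q : Λ'} (hw : IsUnit w) (hu : IsUnit u) (hERL : φ (e₁ (loc₁ z) * e₂ (loc₂ z)) * w = u * Q) :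
    (Literature.NumberTheory.EllipticCurves.Module.charIdeal (IwasawaAlgebra p) X).map φ ≤
      Ideal.span {Q} := by
  -- notation
  set J := Literature.NumberTheory.EllipticCurves.Module.charIdeal (IwasawaAlgebra p)
    (S ⧸ Submodule.span (IwasawaAlgebra p) {z}) with hJ
  obtain ⟨ha₁, h₁⟩ := span_singleton_eq_charIdeal_mul_of_injective loc₁ hloc₁ e₁ hz
  obtain ⟨ha₂, h₂⟩ := span_singleton_eq_charIdeal_mul_of_injective loc₂ hloc₂ e₂ hz
  -- `char X = char C₁ · char C₂ · char Xt`
  have hXmul : Literature.NumberTheory.EllipticCurves.Module.charIdeal (IwasawaAlgebra p) X =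
      Literature.NumberTheory.EllipticCurves.Module.charIdeal (IwasawaAlgebra p)
          (P₁ ⧸ LinearMap.range loc₁) *
        (Literature.NumberTheory.EllipticCurves.Module.charIdeal (IwasawaAlgebra p)
            (P₂ ⧸ LinearMap.range loc₂) *
          Literature.NumberTheory.EllipticCurves.Module.charIdeal (IwasawaAlgebra p) Xt) := by
    rw [charIdeal_eq_mul_of_exact hX ι₁ (LinearMap.range ι₁).mkQ hι₁ (Submodule.mkQ_surjective _)
      (LinearMap.exact_map_mkQ_range ι₁), h233, charIdeal_eq_mul_of_exact hT ι₂ π hι₂ hπ hexact]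
  -- `J` is principal and non-zero
  obtain ⟨j, hj⟩ := (charIdeal_isPrincipal_holds p (S ⧸ Submodule.span (IwasawaAlgebra p) {z})).principal
  have hJj : J = Ideal.span {j} := hj
  have hj0 : j ≠ 0 := by
    rintro rfl
    apply ha₁
    rw [← Ideal.span_singleton_eq_bot, h₁, ← hJ, hJj, Ideal.span_singleton_eq_bot.mpr rfl,
      Ideal.bot_mul]
  -- the key inequality `J² · char X ⊆ J² · (a₁ a₂)`
  have hkey : Ideal.span {j ^ 2} *
      Literature.NumberTheory.EllipticCurves.Module.charIdeal (IwasawaAlgebra p) X ≤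
      Ideal.span {j ^ 2} * Ideal.span {e₁ (loc₁ z) * e₂ (loc₂ z)} := by
    have hsq : Ideal.span {j ^ 2} = J * J := by rw [hJj, ← Ideal.span_singleton_pow, pow_two]
    rw [hsq, hXmul, ← Ideal.span_singleton_mul_span_singleton, h₁, h₂, ← hJ]
    calc J * J * (Literature.NumberTheory.EllipticCurves.Module.charIdeal (IwasawaAlgebra p)
            (P₁ ⧸ LinearMap.range loc₁) *
          (Literature.NumberTheory.EllipticCurves.Module.charIdeal (IwasawaAlgebra p)
              (P₂ ⧸ LinearMap.range loc₂) *
            Literature.NumberTheory.EllipticCurves.Module.charIdeal (IwasawaAlgebra p) Xt))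
        = (J * Literature.NumberTheory.EllipticCurves.Module.charIdeal (IwasawaAlgebra p)
              (P₁ ⧸ LinearMap.range loc₁)) *
            (J * Literature.NumberTheory.EllipticCurves.Module.charIdeal (IwasawaAlgebra p)
              (P₂ ⧸ LinearMap.range loc₂)) *
            Literature.NumberTheory.EllipticCurves.Module.charIdeal (IwasawaAlgebra p) Xt := by ring
      _ ≤ (J * Literature.NumberTheory.EllipticCurves.Module.charIdeal (IwasawaAlgebra p)
              (P₁ ⧸ LinearMap.range loc₁)) *
            (J * Literature.NumberTheory.EllipticCurves.Module.charIdeal (IwasawaAlgebra p)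
              (P₂ ⧸ LinearMap.range loc₂)) * (J ^ 2) := Ideal.mul_mono_right hKS
      _ = J * J * ((J * Literature.NumberTheory.EllipticCurves.Module.charIdeal (IwasawaAlgebra p)
              (P₁ ⧸ LinearMap.range loc₁)) *
            (J * Literature.NumberTheory.EllipticCurves.Module.charIdeal (IwasawaAlgebra p)
              (P₂ ⧸ LinearMap.range loc₂))) := by ring
  have hle : Literature.NumberTheory.EllipticCurves.Module.charIdeal (IwasawaAlgebra p) X ≤
      Ideal.span {e₁ (loc₁ z) * e₂ (loc₂ z)} :=
    (Ideal.span_singleton_mul_right_mono (pow_ne_zero 2 hj0)).mp hkey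
  exact map_le_span_of_le_span_of_units φ hle hw hu hERL

end Transfer

end GeneratorRoad

/-! ### §3 At the tree's `X_ac^∅(E[p^∞])`: the `∃`-body of the crux shape AT A DATUM from (KS) -/

section Datum

variable {W : WeierstrassCurve ℚ} [W.IsElliptic] {p : ℕ} [Fact p.Prime]
  {K : Type} [Field K] [NumberField K]

/-- **H3♭ CORE AT A DATUM from the printed frame, the Poitou–Tate ∕ Coleman skeleton and the
`Λ`-adic Kolyvagin-structure lower bound (KS).** GIVEN a frame `(Ω_K ≠ 0, ‖Ω_p‖ = 1, Q)` with Castella's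
interpolation property (Cas18 Thm. 3.1, `Q = 𝓛_𝔭(f)²`), torsion-ness of the real `X_ac^∅(E_K[p^∞])` (tree
theorem at erratum data) and the hypotheses of `GeneratorRoad.charIdeal_map_le_span_of_heegnerLowerBound`
for that `Q`, the `∃`-body of `P2.IMCDivIntCoreFrameAtErratumData W p` at the datum holds with this
frame. CONDITIONAL on (KS) — NOT in print at `p ∥ N` independently of the erratum (Cas24 Thm. 1.3 is
deduced from it; SZ14-type primitivity + rigidity would give it, PREPRINT) — and on the skeleton; nothing
booked. [cite: Castella2018, Thm. 3.1 (arXiv:1704.06608 p. 9)] [cite: Castella2018Erratum, (2.4) (p. 4)] -/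
theorem P2.imcDivIntCoreFrameAtDatum_of_heegnerLowerBound [NeZero (W.conductorNorm ℤ)]
    (Dt : ModularParametrizationData W (W.conductorNorm ℤ)) (w₀ : InfinitePlace K)
    (κ : ZpExtension K p) (γ : Field.absoluteGaloisGroup K) [Fact (κ.IsTopGenerator γ)]
    (ι' : PadicAlgCl p ≃+* ℂ) {ΩK : ℂ} {Ωp : ℂ_[p]} {Q : PowerSeries 𝓞_ℂ_[p]}
    (hΩ : ΩK ≠ 0) (hΩp : ‖Ωp‖ = 1)
    (hQ : R1.IsBDPLFunctionInt p ι' (primeOfEmbeddingDatum p ι' w₀.embedding) κ γ Dt.f ΩK Ωp Q)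
    (hXt : Module.IsTorsion (IwasawaAlgebra p)
      (XAc (W.baseChange K) p κ (primeOfEmbeddingDatum p ι' w₀.embedding) ∅ γ))
    {T Xt S P₁ P₂ : Type*} [AddCommGroup T] [Module (IwasawaAlgebra p) T]
    [Module.Finite (IwasawaAlgebra p) T] [AddCommGroup Xt] [Module (IwasawaAlgebra p) Xt]
    [Module.Finite (IwasawaAlgebra p) Xt] [AddCommGroup S] [Module (IwasawaAlgebra p) S]
    [AddCommGroup P₁] [Module (IwasawaAlgebra p) P₁] [AddCommGroup P₂] [Module (IwasawaAlgebra p) P₂]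
    (hT : Module.IsTorsion (IwasawaAlgebra p) T) {z : S} (hz : z ≠ 0)
    (loc₁ : S →ₗ[IwasawaAlgebra p] P₁) (hloc₁ : Function.Injective loc₁)
    (e₁ : P₁ ≃ₗ[IwasawaAlgebra p] IwasawaAlgebra p)
    (ι₁ : (P₁ ⧸ LinearMap.range loc₁) →ₗ[IwasawaAlgebra p]
      XAc (W.baseChange K) p κ (primeOfEmbeddingDatum p ι' w₀.embedding) ∅ γ)
    (hι₁ : Function.Injective ι₁)
    (h233 : Literature.NumberTheory.EllipticCurves.Module.charIdeal (IwasawaAlgebra p)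
        (XAc (W.baseChange K) p κ (primeOfEmbeddingDatum p ι' w₀.embedding) ∅ γ ⧸
          LinearMap.range ι₁) =
      Literature.NumberTheory.EllipticCurves.Module.charIdeal (IwasawaAlgebra p) T)
    (loc₂ : S →ₗ[IwasawaAlgebra p] P₂) (hloc₂ : Function.Injective loc₂)
    (e₂ : P₂ ≃ₗ[IwasawaAlgebra p] IwasawaAlgebra p)
    (ι₂ : (P₂ ⧸ LinearMap.range loc₂) →ₗ[IwasawaAlgebra p] T) (π : T →ₗ[IwasawaAlgebra p] Xt)
    (hι₂ : Function.Injective ι₂) (hπ : Function.Surjective π) (hexact : Function.Exact ι₂ π)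
    (hKS : Literature.NumberTheory.EllipticCurves.Module.charIdeal (IwasawaAlgebra p) Xt ≤
      Literature.NumberTheory.EllipticCurves.Module.charIdeal (IwasawaAlgebra p)
        (S ⧸ Submodule.span (IwasawaAlgebra p) {z}) ^ 2)
    {w u : PowerSeries 𝓞_ℂ_[p]} (hw : IsUnit w) (hu : IsUnit u)
    (hERL : PowerSeries.map (R1.toCpInt p) (e₁ (loc₁ z) * e₂ (loc₂ z)) * w = u * Q) :
    ∃ (ΩK : ℂ) (Ωp : ℂ_[p]) (Q : PowerSeries 𝓞_ℂ_[p]), ΩK ≠ 0 ∧ ‖Ωp‖ = 1 ∧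
      R1.IsBDPLFunctionInt p ι' (primeOfEmbeddingDatum p ι' w₀.embedding) κ γ Dt.f ΩK Ωp Q ∧
      (XAc.charIdeal (W.baseChange K) p κ (primeOfEmbeddingDatum p ι' w₀.embedding) ∅ γ).map
          (PowerSeries.map (R1.toCpInt p)) ≤ Ideal.span {Q} := by
  haveI : Module.Finite (IwasawaAlgebra p)
      (XAc (W.baseChange K) p κ (primeOfEmbeddingDatum p ι' w₀.embedding) ∅ γ) :=
    XAc.module_finite_empty κ _ γ
  exact ⟨ΩK, Ωp, Q, hΩ, hΩp, hQ,
    GeneratorRoad.charIdeal_map_le_span_of_heegnerLowerBound (PowerSeries.map (R1.toCpInt p)) hXt hT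
      hz loc₁ hloc₁ e₁ ι₁ hι₁ h233 loc₂ hloc₂ e₂ ι₂ π hι₂ hπ hexact hKS hw hu hERL⟩

end Datum

end Summit.BirchSwinnertonDyer.Rank1Residual.X11b
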